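import Mathlib
import HarnessLib

/-!
# MOMENT-FLOOR TOOLS (class-free real analysis / measure theory for nsreg-p2 ROUND-53 «THE FLOOR»; seat ns-ezl-w3 g8,
# `--supports stmt-NavierStokesRegularity-19832 --as helper`)

Three generic tools for TWO-SIDED statements about the normalised vorticity moments `m_q(R) = R^{−a_q}∫_{B_R}‖Ω‖^q` of a self-similar
profile (the t56-SM ODE `γR·M_q′ = (3γ−q)M_q + q·Str_q − U_q/R` has an absolutely integrable error after normalisation):

* (F2) `MomentFloor.tendsto_atTop_of_hasDerivAt_of_integrableOn_Ioi` — a function with an integrable derivative on `(a, ∞)` CONVERGES at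
  `+∞`, to `m a + ∫_{(a,∞)} m′`; `MomentFloor.abs_sub_lim_le_integral_Ioi` — with the rate `|m R − L| ≤ ∫_{(R,∞)} |m′|`;
* (F5) `MomentFloor.integral_rpow_le_measureReal_support_rpow_mul` — HÖLDER WITH THE SUPPORT (Lyapunov interpolation between the orders `0`
  and `q₂`): `∫ f^{q₁} dμ ≤ μ{f ≠ 0}^{1 − q₁/q₂} · (∫ f^{q₂} dμ)^{q₁/q₂}` for `0 < q₁ < q₂`, `f ≥ 0` — positivity of a low moment is carried
  by the support volume and a higher moment (log-convexity of `q ↦ ∫ f^q`);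
* (F6) `MomentFloor.integral_rpow_le_add_measureReal_superlevel` — the PALEY–ZYGMUND form:
  `∫ f^{q₁} dμ ≤ λ^{q₁}·μ(univ) + μ{λ ≤ f}^{1−q₁/q₂}·(∫ f^{q₂} dμ)^{q₁/q₂}` (finite `μ`, `λ > 0`) — a low moment above the trivial level forces a
  super-level set of positive measure, quantitatively.

All for an arbitrary measure space (so that smooth radial weights `φ(‖y‖/R)dy` and sharp balls are both covered).
HONEST FRAMING: tools only; nothing about the crux E (`PowerGaugeEulerLiouville`, stmt 19832, OPEN) or NS regularity is proved here; not E. [folklore]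
-/

noncomputable section

set_option linter.dupNamespace false

open Set Filter Topology Metric Function MeasureTheory
open scoped Topology ENNReal

namespace Summit.NavierStokesRegularity.NavierStokesRegularity.Theorems.PowerGaugeEulerLiouville

namespace MomentFloor

/-! ## (F2) Convergence at `+∞` from an integrable derivative -/

/-- **(F2) A function with an integrable derivative on `(a, ∞)` converges at `+∞`**: if `m` is continuous from the right at `a`, has derivative
`m′` on `(a, ∞)` and `m′ ∈ L¹((a, ∞))`, then `m(R) → m(a) + ∫_{(a,∞)} m′` as `R → ∞` (FTC on `[a, R]` and `∫_a^R m′ → ∫_{(a,∞)} m′`). [folklore] -/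
theorem tendsto_atTop_of_hasDerivAt_of_integrableOn_Ioi {m m' : ℝ → ℝ} {a : ℝ}
    (hcont : ContinuousWithinAt m (Ici a) a) (hderiv : ∀ x ∈ Ioi a, HasDerivAt m (m' x) x)
    (hint : IntegrableOn m' (Ioi a)) :
    Tendsto m atTop (𝓝 (m a + ∫ x in Ioi a, m' x)) := by
  -- FTC on `[a, R]`
  have hFTC : ∀ R, a ≤ R → ∫ x in a..R, m' x = m R - m a := by
    intro R hR
    refine intervalIntegral.integral_eq_sub_of_hasDerivAt_of_le hR ?_ (fun x hx => hderiv x hx.1)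
      ((intervalIntegrable_iff_integrableOn_Ioc_of_le hR).2 (hint.mono_set Ioc_subset_Ioi_self))
    intro x hx
    rcases eq_or_lt_of_le hx.1 with h | h
    · subst h
      exact hcont.mono Icc_subset_Ici_self
    · exact (hderiv x h).continuousAt.continuousWithinAt
  have hlim := intervalIntegral_tendsto_integral_Ioi a hint tendsto_id
  have hev : (fun R => m a + ∫ x in a..R, m' x) =ᶠ[atTop] m := by
    filter_upwards [eventually_ge_atTop a] with R hR
    rw [hFTC R hR]; ring
  exact (tendsto_const_nhds.add hlim).congr' hev

/-- **(F2, rate)** under the same hypotheses, for every `R ≥ a`: `|m(R) − (m(a) + ∫_{(a,∞)} m′)| ≤ ∫_{(R,∞)} |m′|`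
(`∫_{(R,∞)} m′ = L − m(R)`, Mathlib `integral_Ioi_of_hasDerivAt_of_tendsto`). [folklore] -/
theorem abs_sub_lim_le_integral_Ioi {m m' : ℝ → ℝ} {a : ℝ}
    (hcont : ContinuousWithinAt m (Ici a) a) (hderiv : ∀ x ∈ Ioi a, HasDerivAt m (m' x) x)
    (hint : IntegrableOn m' (Ioi a)) {R : ℝ} (hR : a ≤ R) :
    |m R - (m a + ∫ x in Ioi a, m' x)| ≤ ∫ x in Ioi R, |m' x| := by
  have hlim := tendsto_atTop_of_hasDerivAt_of_integrableOn_Ioi hcont hderiv hint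
  have hcontR : ContinuousWithinAt m (Ici R) R := by
    rcases eq_or_lt_of_le hR with h | h
    · subst h; exact hcont
    · exact (hderiv R h).continuousAt.continuousWithinAt
  have hderivR : ∀ x ∈ Ioi R, HasDerivAt m (m' x) x := fun x hx => hderiv x (lt_of_le_of_lt hR hx)
  have hintR : IntegrableOn m' (Ioi R) := hint.mono_set (Ioi_subset_Ioi hR)
  have hI := integral_Ioi_of_hasDerivAt_of_tendsto hcontR hderivR hintR hlim
  calc |m R - (m a + ∫ x in Ioi a, m' x)| = |∫ x in Ioi R, m' x| := by rw [hI]; ring_nf; rw [abs_sub_comm]; ring_nf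
    _ = ‖∫ x in Ioi R, m' x‖ := (Real.norm_eq_abs _).symm
    _ ≤ ∫ x in Ioi R, ‖m' x‖ := norm_integral_le_integral_norm _
    _ = ∫ x in Ioi R, |m' x| := by simp only [Real.norm_eq_abs]

/-! ## (F5) Hölder with the support -/

variable {α : Type*} [MeasurableSpace α] {μ : Measure α}

/-- **(F5) HÖLDER WITH THE SUPPORT** (Lyapunov interpolation between the orders `0` and `q₂`): for `f ≥ 0` measurable, `0 < q₁ < q₂`,
`f^{q₂} ∈ L¹(μ)` and `μ{f ≠ 0} < ∞`: `∫ f^{q₁} dμ ≤ μ{f ≠ 0}^{1 − q₁/q₂} · (∫ f^{q₂} dμ)^{q₁/q₂}` — Hölder for `f^{q₁}·𝟙_{f≠0}` with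
exponents `q₂/q₁` and `(1 − q₁/q₂)^{−1}`. [folklore] -/
theorem integral_rpow_le_measureReal_support_rpow_mul {f : α → ℝ} (hf0 : ∀ x, 0 ≤ f x) (hfm : Measurable f)
    {q₁ q₂ : ℝ} (hq₁ : 0 < q₁) (hq₁₂ : q₁ < q₂) (hint : Integrable (fun x => f x ^ q₂) μ)
    (hsupp : μ {x | f x ≠ 0} ≠ ⊤) :
    ∫ x, f x ^ q₁ ∂μ ≤ (μ.real {x | f x ≠ 0}) ^ (1 - q₁ / q₂) * (∫ x, f x ^ q₂ ∂μ) ^ (q₁ / q₂) := by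
  have hq₂ : 0 < q₂ := hq₁.trans hq₁₂
  have hr : 0 < q₁ / q₂ := div_pos hq₁ hq₂
  have hr1 : q₁ / q₂ < 1 := (div_lt_one hq₂).2 hq₁₂
  have hS : MeasurableSet {x | f x ≠ 0} := hfm (measurableSet_singleton 0).compl
  -- Hölder in `ℝ≥0∞` for `F = ofReal (f^{q₁})`, `G = 𝟙_{f ≠ 0}`
  have hPQ : (q₁ / q₂)⁻¹.HolderConjugate (1 - q₁ / q₂)⁻¹ :=
    Real.HolderConjugate.inv_inv hr (by linarith) (by ring)
  set F : α → ℝ≥0∞ := fun x => ENNReal.ofReal (f x ^ q₁) with hFdef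
  set G : α → ℝ≥0∞ := fun x => Set.indicator {x | f x ≠ 0} (fun _ => (1 : ℝ≥0∞)) x with hGdef
  have hF : AEMeasurable F μ := (hfm.pow_const q₁).ennreal_ofReal.aemeasurable
  have hG : AEMeasurable G μ := (aemeasurable_const.indicator hS)
  have hH := ENNReal.lintegral_mul_le_Lp_mul_Lq μ hPQ hF hG
  -- `F·G = F` (where `f = 0`, `f^{q₁} = 0`)
  have hFG : (fun x => (F * G) x) = F := by
    funext x
    simp only [Pi.mul_apply, hGdef, hFdef]
    by_cases hx : f x ≠ 0
    · rw [Set.indicator_of_mem (by exact hx), mul_one]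
    · rw [Set.indicator_of_notMem (by exact hx), mul_zero]
      rw [not_not] at hx
      rw [hx, Real.zero_rpow hq₁.ne', ENNReal.ofReal_zero]
  -- integrability of `f^{q₁}`: `f^{q₁} ≤ 𝟙_{f≠0} + f^{q₂}`
  have hfq₁_int : Integrable (fun x => f x ^ q₁) μ := by
    have hb : ∀ x, f x ^ q₁ ≤ Set.indicator {x | f x ≠ 0} (fun _ => (1 : ℝ)) x + f x ^ q₂ := by
      intro x
      by_cases hx : f x ≠ 0
      · rw [Set.indicator_of_mem (by exact hx)]
        rcases le_or_gt (f x) 1 with h1 | h1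
        · have : f x ^ q₁ ≤ 1 := Real.rpow_le_one (hf0 x) h1 hq₁.le
          linarith [Real.rpow_nonneg (hf0 x) q₂]
        · have : f x ^ q₁ ≤ f x ^ q₂ := Real.rpow_le_rpow_of_exponent_le h1.le hq₁₂.le
          linarith
      · rw [not_not] at hx
        rw [Set.indicator_of_notMem (by simpa using hx), hx, Real.zero_rpow hq₁.ne', Real.zero_rpow hq₂.ne', add_zero]
    have hind : Integrable (fun x => Set.indicator {x | f x ≠ 0} (fun _ => (1 : ℝ)) x) μ :=
      (integrable_indicator_iff hS).2 (integrableOn_const hsupp)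
    refine Integrable.mono' (hind.add hint) (hfm.pow_const q₁).aestronglyMeasurable (ae_of_all _ fun x => ?_)
    rw [Real.norm_eq_abs, abs_of_nonneg (Real.rpow_nonneg (hf0 x) q₁)]
    exact hb x
  -- evaluate the three lintegrals
  have e1 : ∫⁻ x, (F * G) x ∂μ = ENNReal.ofReal (∫ x, f x ^ q₁ ∂μ) := by
    rw [hFG, hFdef, ofReal_integral_eq_lintegral_ofReal hfq₁_int (ae_of_all _ fun x => Real.rpow_nonneg (hf0 x) q₁)]
  have e2 : ∫⁻ x, F x ^ (q₁ / q₂)⁻¹ ∂μ = ENNReal.ofReal (∫ x, f x ^ q₂ ∂μ) := by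
    have : ∀ x, F x ^ (q₁ / q₂)⁻¹ = ENNReal.ofReal (f x ^ q₂) := by
      intro x
      rw [hFdef]
      simp only
      rw [ENNReal.ofReal_rpow_of_nonneg (Real.rpow_nonneg (hf0 x) q₁) (by positivity), ← Real.rpow_mul (hf0 x)]
      congr 2
      field_simp
    simp_rw [this]
    rw [ofReal_integral_eq_lintegral_ofReal hint (ae_of_all _ fun x => Real.rpow_nonneg (hf0 x) q₂)]
  have e3 : ∫⁻ x, G x ^ (1 - q₁ / q₂)⁻¹ ∂μ = μ {x | f x ≠ 0} := by
    have : ∀ x, G x ^ (1 - q₁ / q₂)⁻¹ = G x := by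
      intro x
      rw [hGdef]
      simp only
      by_cases hx : x ∈ {x | f x ≠ 0}
      · rw [Set.indicator_of_mem hx, ENNReal.one_rpow]
      · rw [Set.indicator_of_notMem hx, ENNReal.zero_rpow_of_pos (by rw [inv_pos]; linarith)]
    simp_rw [this]
    rw [hGdef, lintegral_indicator hS, setLIntegral_const, one_mul]
  rw [e1, e2, e3] at hH
  -- pass to real numbers
  have hI0 : 0 ≤ ∫ x, f x ^ q₁ ∂μ := integral_nonneg fun x => Real.rpow_nonneg (hf0 x) q₁
  have hJ0 : 0 ≤ ∫ x, f x ^ q₂ ∂μ := integral_nonneg fun x => Real.rpow_nonneg (hf0 x) q₂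
  have hfin : ENNReal.ofReal (∫ x, f x ^ q₂ ∂μ) ^ (1 / (q₁ / q₂)⁻¹) * μ {x | f x ≠ 0} ^ (1 / (1 - q₁ / q₂)⁻¹) ≠ ⊤ :=
    ENNReal.mul_ne_top (ENNReal.rpow_ne_top_of_nonneg (by positivity) ENNReal.ofReal_ne_top)
      (ENNReal.rpow_ne_top_of_nonneg (by simp only [one_div, inv_inv]; linarith) hsupp)
  have := ENNReal.toReal_mono hfin hH
  rw [ENNReal.toReal_ofReal hI0, ENNReal.toReal_mul, ← ENNReal.toReal_rpow, ← ENNReal.toReal_rpow,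
    ENNReal.toReal_ofReal hJ0] at this
  simp only [one_div, inv_inv] at this
  rw [mul_comm]
  exact this

/-! ## (F6) The Paley–Zygmund form -/

/-- **(F6) PALEY–ZYGMUND for moments**: for a finite measure `μ`, `f ≥ 0` measurable, `0 < q₁ < q₂`, `f^{q₂} ∈ L¹(μ)` and a level `λ > 0`:
`∫ f^{q₁} dμ ≤ λ^{q₁}·μ(univ) + μ{λ ≤ f}^{1 − q₁/q₂}·(∫ f^{q₂} dμ)^{q₁/q₂}` (split at the level `λ`; (F5) for `f·𝟙_{λ ≤ f}`). Read backwards: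
a `q₁`-moment above `λ^{q₁}μ(univ)` forces `μ{f ≥ λ} > 0`, quantitatively in the `q₂`-moment. [folklore] -/
theorem integral_rpow_le_add_measureReal_superlevel [IsFiniteMeasure μ] {f : α → ℝ} (hf0 : ∀ x, 0 ≤ f x)
    (hfm : Measurable f) {q₁ q₂ : ℝ} (hq₁ : 0 < q₁) (hq₁₂ : q₁ < q₂) (hint : Integrable (fun x => f x ^ q₂) μ)
    {l : ℝ} (hl : 0 < l) :
    ∫ x, f x ^ q₁ ∂μ ≤ l ^ q₁ * μ.real univ +
      (μ.real {x | l ≤ f x}) ^ (1 - q₁ / q₂) * (∫ x, f x ^ q₂ ∂μ) ^ (q₁ / q₂) := by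
  have hq₂ : 0 < q₂ := hq₁.trans hq₁₂
  have hL : MeasurableSet {x | l ≤ f x} := measurableSet_le measurable_const hfm
  -- the truncated function `g = f·𝟙_{l ≤ f}`
  set g : α → ℝ := fun x => Set.indicator {x | l ≤ f x} f x with hgdef
  have hg0 : ∀ x, 0 ≤ g x := fun x => by
    rw [hgdef]; simp only
    by_cases hx : x ∈ {x | l ≤ f x}
    · rw [Set.indicator_of_mem hx]; exact hf0 x
    · rw [Set.indicator_of_notMem hx]
  have hgm : Measurable g := hfm.indicator hL
  have hg_le : ∀ x (q : ℝ), 0 < q → g x ^ q ≤ f x ^ q := fun x q hq => by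
    rw [hgdef]; simp only
    by_cases hx : x ∈ {x | l ≤ f x}
    · rw [Set.indicator_of_mem hx]
    · rw [Set.indicator_of_notMem hx, Real.zero_rpow hq.ne']; exact Real.rpow_nonneg (hf0 x) q
  have hgint : Integrable (fun x => g x ^ q₂) μ :=
    Integrable.mono' hint (hgm.pow_const q₂).aestronglyMeasurable (ae_of_all _ fun x => by
      rw [Real.norm_eq_abs, abs_of_nonneg (Real.rpow_nonneg (hg0 x) q₂)]; exact hg_le x q₂ hq₂)
  have hgsupp : {x | g x ≠ 0} ⊆ {x | l ≤ f x} := fun x hx => by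
    by_contra hcon
    apply hx
    rw [hgdef]; simp only; rw [Set.indicator_of_notMem hcon]
  -- pointwise split: `f^{q₁} ≤ l^{q₁} + g^{q₁}`
  have hsplit : ∀ x, f x ^ q₁ ≤ l ^ q₁ + g x ^ q₁ := fun x => by
    rw [hgdef]; simp only
    by_cases hx : x ∈ {x | l ≤ f x}
    · rw [Set.indicator_of_mem hx]; linarith [Real.rpow_nonneg hl.le q₁]
    · rw [Set.indicator_of_notMem hx, Real.zero_rpow hq₁.ne', add_zero]
      have hfl : f x ≤ l := le_of_lt (not_le.1 hx)
      exact Real.rpow_le_rpow (hf0 x) hfl hq₁.le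
  -- integrability of `f^{q₁}`, `g^{q₁}` on the finite measure space: `≤ 1 + f^{q₂}`
  have hpow_int : ∀ {h : α → ℝ}, (∀ x, 0 ≤ h x) → Measurable h → Integrable (fun x => h x ^ q₂) μ →
      Integrable (fun x => h x ^ q₁) μ := by
    intro h hh0 hhm hhint
    have hb : ∀ x, h x ^ q₁ ≤ 1 + h x ^ q₂ := fun x => by
      rcases le_or_gt (h x) 1 with h1 | h1
      · have : h x ^ q₁ ≤ 1 := Real.rpow_le_one (hh0 x) h1 hq₁.le
        linarith [Real.rpow_nonneg (hh0 x) q₂]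
      · have : h x ^ q₁ ≤ h x ^ q₂ := Real.rpow_le_rpow_of_exponent_le h1.le hq₁₂.le
        linarith
    exact Integrable.mono' ((integrable_const (1 : ℝ)).add hhint) (hhm.pow_const q₁).aestronglyMeasurable
      (ae_of_all _ fun x => by rw [Real.norm_eq_abs, abs_of_nonneg (Real.rpow_nonneg (hh0 x) q₁)]; exact hb x)
  have hfq₁ : Integrable (fun x => f x ^ q₁) μ := hpow_int hf0 hfm hint
  have hgq₁ : Integrable (fun x => g x ^ q₁) μ := hpow_int hg0 hgm hgint
  -- integrate the split
  have h1 : ∫ x, f x ^ q₁ ∂μ ≤ ∫ x, (l ^ q₁ + g x ^ q₁) ∂μ :=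
    integral_mono hfq₁ ((integrable_const _).add hgq₁) hsplit
  rw [integral_add (integrable_const _) hgq₁, integral_const, smul_eq_mul, mul_comm] at h1
  -- (F5) for `g`, then monotonicity in the support and in the `q₂`-moment
  have hsuppfin : μ {x | g x ≠ 0} ≠ ⊤ := measure_ne_top μ _
  have h2 := integral_rpow_le_measureReal_support_rpow_mul hg0 hgm hq₁ hq₁₂ hgint hsuppfin
  have hr0 : 0 ≤ 1 - q₁ / q₂ := by
    have : q₁ / q₂ < 1 := (div_lt_one hq₂).2 hq₁₂
    linarith
  have h3 : (μ.real {x | g x ≠ 0}) ^ (1 - q₁ / q₂) ≤ (μ.real {x | l ≤ f x}) ^ (1 - q₁ / q₂) :=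
    Real.rpow_le_rpow measureReal_nonneg (measureReal_mono hgsupp (measure_ne_top μ _)) hr0
  have h4 : (∫ x, g x ^ q₂ ∂μ) ^ (q₁ / q₂) ≤ (∫ x, f x ^ q₂ ∂μ) ^ (q₁ / q₂) :=
    Real.rpow_le_rpow (integral_nonneg fun x => Real.rpow_nonneg (hg0 x) q₂)
      (integral_mono hgint hint fun x => hg_le x q₂ hq₂) (div_pos hq₁ hq₂).le
  have h5 : (μ.real {x | g x ≠ 0}) ^ (1 - q₁ / q₂) * (∫ x, g x ^ q₂ ∂μ) ^ (q₁ / q₂) ≤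
      (μ.real {x | l ≤ f x}) ^ (1 - q₁ / q₂) * (∫ x, f x ^ q₂ ∂μ) ^ (q₁ / q₂) :=
    mul_le_mul h3 h4 (Real.rpow_nonneg (integral_nonneg fun x => Real.rpow_nonneg (hg0 x) q₂) _)
      (Real.rpow_nonneg measureReal_nonneg _)
  linarith

end MomentFloor

end Summit.NavierStokesRegularity.NavierStokesRegularity.Theorems.PowerGaugeEulerLiouville

end
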